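import Summits.CriticalPhenomena.PercolationContinuityZ3.Theorems.PercLowPointHalfSpaceTallClusterMassBoundStubSubharmonicTransfer

/-!
# `TallClusterMassBound` (stmt-CriticalPhenomena-0912), line `SketchIdeator4` — ARROW 1 sharpened:
# the logarithm of ARROW 1 is the logarithm of a first-moment RATIO

Helper stubs of the skeleton `Cruxes/TallClusterMassBound/Lines/SketchIdeator4.lean`
(crux `…Theses.PercLowPointHalfSpace.TallClusterMassBound`, item B of route PercLowPointHalfSpace).

The landed ARROW 1 (`mass_le_typicalMax_mul_log`) reads, for EVERY `p` and `r`,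
`M_p(r) ≤ (2 + 3e^{3/2}) · M · π · (1 + log(1/π))` with `M = typicalMax P^ℍ_p Λ_r`, `π = π_p(r)`,
`Λ_r = halfBox r`, `P^ℍ_p = floorDilutedPercolation 3 p 1`. Its proof bounds the factor
`q := P^ℍ_p(|K_0 ∩ Λ_r| ≥ M)` of Hutchcroft's ROOTED universal tightness
`P(|K_0 ∩ Λ| ≥ αM) ≤ e^{(3-α)/2} · P(|K_0 ∩ Λ| ≥ M)` by `1`. Keeping it:

* `mass_le_typicalMax_mul_log_ratio` — `M_p(r) ≤ (2 + 3e^{3/2}) · M · π · (1 + log⁺(q/π))`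
  (threshold `T = M + ⌈2M log⁺(q/π)⌉`; `e^{-T/(2M)} q ≤ e^{-log⁺(q/π)} q ≤ π`);
* `mass_le_typicalMax_mul_log_chiRatio` — `M_p(r) ≤ (2 + 3e^{3/2}) · M · π · (1 + log⁺(χ_ℍ^{(r)}(p)/(Mπ)))`
  (Markov `M q ≤ E^ℍ|K_0 ∩ Λ_r| = Σ_{y ∈ Λ_r} P^ℍ(0 ↔ y) ≤ Σ_{y ∈ Λ_r} P_p(0 ↔_ℍ y) ≤ χ_ℍ^{(r)}(p)`):
  the whole logarithmic loss of ARROW 1 is `log⁺` of the single `ℍ`-native first-moment ratio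
  `W(r) := χ_ℍ^{(r)} / (M π)` (`≥ 1/(2+3e^{3/2}) - O(1/log)` by Harris–FKG `χ_ℍ π ≤ M_p(r)`);
* `massBoundAt_of_typicalMax_le_of_chiRatio` — `typicalMax ≤ C r^s` and `W(r) ≤ K` give `MassBoundAt p_c s`
  with NO loss in the exponent;
* `tallClusterMassBound_of_squareSubharmonic_of_chiRatio` — **B ⟸ `SquareSubharmonic` (stmt-11506, verbatim)
  ∧ `W` bounded**: `SquareSubharmonic` puts `typicalMax ≲ r^{11/4}` exactly on the threshold
  (`massBoundAt_of_squareSubharmonic` loses `ε` to the `log r`); a bounded ratio `W` removes the `log`.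
No definitions; no criticality enters §1–§2.
-/

noncomputable section

open MeasureTheory Finset Filter
open Literature.Probability.Percolation Literature.Probability.LatticeModels
open Summit.CriticalPhenomena.PercolationContinuityZ3.Theses.PercLowPointHalfSpace (TallClusterMassBound)
open Summit.CriticalPhenomena.PercolationContinuityZ3.Theses.PercSubharmonicSquare (SquareSubharmonic)
open Summit.CriticalPhenomena.PercolationContinuityZ3.Theorems.TallClusterMassBound.Negative

namespace Summit.CriticalPhenomena.PercolationContinuityZ3.Theorems.TallClusterMassBound.TightnessLine

/-! ## §1 Rooted universal tightness keeping the factor `q = P^ℍ_p(|K_0 ∩ Λ_r| ≥ M)` -/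

/-- **Rooted universal tightness, exponential form with the root factor**: for `n ≥ M = typicalMax P^ℍ_p Λ_r`,
`P^ℍ_p(|K_0 ∩ Λ_r| ≥ n) ≤ e^{3/2} (e^{-1/(2M)})^n · P^ℍ_p(|K_0 ∩ Λ_r| ≥ M)` (Hutchcroft 2021, Thm 2.2 (2.5), tree
`prodBernoulli_real_clusterCapIn_ge_le_exp_mul` with `α = n/M`). [folklore] -/
theorem real_clusterCapIn_ge_le_exp_mul_root (p : unitInterval) {r n : ℕ}
    (hn : typicalMax (floorDilutedPercolation 3 p 1) (halfBox r) ≤ n) :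
    (floorDilutedPercolation 3 p 1).real {ω | n ≤ clusterCapIn (halfBox r) ω 0} ≤
      Real.exp (3 / 2) *
        Real.exp (-1 / (2 * typicalMax (floorDilutedPercolation 3 p 1) (halfBox r))) ^ n *
          (floorDilutedPercolation 3 p 1).real
            {ω | typicalMax (floorDilutedPercolation 3 p 1) (halfBox r) ≤ clusterCapIn (halfBox r) ω 0} := by
  have hμ : floorDilutedPercolation 3 p 1 = prodBernoulli (floorDilutedParam 3 p 1) := rfl
  rw [hμ] at hn ⊢
  set μ := prodBernoulli (floorDilutedParam 3 p 1) with hμdef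
  set M := typicalMax μ (halfBox r) with hMdef
  have hM2 : 2 ≤ M := two_le_typicalMax μ (halfBox_nonempty r)
  have hMR : (2 : ℝ) ≤ M := by exact_mod_cast hM2
  have hM0 : (0 : ℝ) < M := by linarith
  have hα : (1 : ℝ) ≤ n / M := by
    rw [le_div_iff₀ hM0, one_mul]
    exact_mod_cast hn
  have key := prodBernoulli_real_clusterCapIn_ge_le_exp_mul (floorDilutedParam 3 p 1)
    (halfBox_nonempty r) (0 : V3) hα
  have hsub : {ω : BondConfig V3 | n ≤ clusterCapIn (halfBox r) ω 0} ⊆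
      {ω | (n : ℝ) / M * M ≤ (clusterCapIn (halfBox r) ω 0 : ℝ)} := by
    intro ω hω
    simp only [Set.mem_setOf_eq] at hω ⊢
    rw [div_mul_cancel₀ _ hM0.ne']
    exact_mod_cast hω
  have hexp : Real.exp ((3 - n / M) / 2) = Real.exp (3 / 2) * Real.exp (-1 / (2 * M)) ^ n := by
    rw [← Real.exp_nat_mul, ← Real.exp_add]
    congr 1
    field_simp
    ring
  calc μ.real {ω | n ≤ clusterCapIn (halfBox r) ω 0}
      ≤ μ.real {ω | (n : ℝ) / M * M ≤ (clusterCapIn (halfBox r) ω 0 : ℝ)} :=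
        measureReal_mono hsub (measure_ne_top _ _)
    _ ≤ Real.exp ((3 - n / M) / 2) * μ.real {ω | M ≤ clusterCapIn (halfBox r) ω 0} := key
    _ = Real.exp (3 / 2) * Real.exp (-1 / (2 * M)) ^ n * μ.real {ω | M ≤ clusterCapIn (halfBox r) ω 0} := by
        rw [hexp]

/-- A geometric tail: `Σ_{n = T+1}^{N-1} ρ^n ≤ ρ^T · B` whenever `0 ≤ ρ < 1` and `1/(1-ρ) ≤ B`. [folklore] -/
theorem geom_sum_Ico_succ_le_pow_mul {ρ B : ℝ} (hρ0 : 0 ≤ ρ) (hρ1 : ρ < 1) (hB : 1 / (1 - ρ) ≤ B) (T N : ℕ) :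
    ∑ n ∈ Finset.Ico (T + 1) N, ρ ^ n ≤ ρ ^ T * B := by
  have h1r : 0 < 1 - ρ := by linarith
  calc ∑ n ∈ Finset.Ico (T + 1) N, ρ ^ n ≤ ρ ^ (T + 1) / (1 - ρ) := geom_sum_Ico_le_of_lt_one hρ0 hρ1
    _ ≤ ρ ^ T / (1 - ρ) := by
        refine div_le_div_of_nonneg_right ?_ h1r.le
        rw [pow_succ]
        exact mul_le_of_le_one_right (pow_nonneg hρ0 _) hρ1.le
    _ = ρ ^ T * (1 / (1 - ρ)) := by rw [← mul_one_div]
    _ ≤ ρ ^ T * B := mul_le_mul_of_nonneg_left hB (pow_nonneg hρ0 _)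

/-- `1/(1 - e^{-1/(2M)}) ≤ 1 + 2M` for `M > 0` (`1 + x ≤ e^x`). [folklore] -/
theorem one_div_one_sub_exp_le {M : ℝ} (hM0 : 0 < M) : 1 / (1 - Real.exp (-1 / (2 * M))) ≤ 1 + 2 * M := by
  set ρ := Real.exp (-1 / (2 * M)) with hρ
  have hρ0 : 0 ≤ ρ := (Real.exp_pos _).le
  have hρ1 : ρ < 1 := Real.exp_lt_one_iff.2 (by
    rw [neg_div]
    exact neg_neg_of_pos (by positivity))
  have h1r : 0 < 1 - ρ := by linarith
  have hexp : 1 + 1 / (2 * M) ≤ Real.exp (1 / (2 * M)) := by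
    have := Real.add_one_le_exp (1 / (2 * M))
    linarith
  have hr' : ρ * Real.exp (1 / (2 * M)) = 1 := by
    rw [hρ, ← Real.exp_add, show -1 / (2 * M) + 1 / (2 * M) = 0 by ring, Real.exp_zero]
  have hrle : ρ * (1 + 1 / (2 * M)) ≤ 1 := by
    calc ρ * (1 + 1 / (2 * M)) ≤ ρ * Real.exp (1 / (2 * M)) := mul_le_mul_of_nonneg_left hexp hρ0
      _ = 1 := hr'
  rw [div_le_iff₀ h1r]
  have : (1 + 2 * M) * (1 - ρ) = 1 + 2 * M - 2 * M * (ρ * (1 + 1 / (2 * M))) := by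
    field_simp
    ring
  rw [this]
  nlinarith

/-- **Geometric tail with the root factor**: for `T ≥ M`,
`Σ_{n = T+1}^{|Λ_r|} P^ℍ_p(|K_0 ∩ Λ_r| ≥ n) ≤ e^{3/2} (e^{-1/(2M)})^T (1 + 2M) · P^ℍ_p(|K_0 ∩ Λ_r| ≥ M)`. [folklore] -/
theorem sum_Ico_real_clusterCapIn_ge_le_mul_root (p : unitInterval) (r : ℕ) {T : ℕ}
    (hT : typicalMax (floorDilutedPercolation 3 p 1) (halfBox r) ≤ T) :
    ∑ n ∈ Finset.Ico (T + 1) ((halfBox r).card + 1),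
        (floorDilutedPercolation 3 p 1).real {ω | n ≤ clusterCapIn (halfBox r) ω 0} ≤
      Real.exp (3 / 2) *
        Real.exp (-1 / (2 * typicalMax (floorDilutedPercolation 3 p 1) (halfBox r))) ^ T *
          (1 + 2 * typicalMax (floorDilutedPercolation 3 p 1) (halfBox r)) *
            (floorDilutedPercolation 3 p 1).real
              {ω | typicalMax (floorDilutedPercolation 3 p 1) (halfBox r) ≤ clusterCapIn (halfBox r) ω 0} := by
  set μ := floorDilutedPercolation 3 p 1 with hμ
  set M := typicalMax μ (halfBox r) with hMdef
  set q := μ.real {ω | M ≤ clusterCapIn (halfBox r) ω 0} with hqdef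
  have hq0 : 0 ≤ q := measureReal_nonneg
  have hM2 : 2 ≤ M := two_le_typicalMax μ (halfBox_nonempty r)
  have hMR : (2 : ℝ) ≤ M := by exact_mod_cast hM2
  have hM0 : (0 : ℝ) < M := by linarith
  set ρ := Real.exp (-1 / (2 * (M : ℝ))) with hρ
  have hρ0 : 0 ≤ ρ := (Real.exp_pos _).le
  have hρ1 : ρ < 1 := Real.exp_lt_one_iff.2 (by
    rw [neg_div]
    exact neg_neg_of_pos (by positivity))
  have hterm : ∀ n ∈ Finset.Ico (T + 1) ((halfBox r).card + 1),
      μ.real {ω | n ≤ clusterCapIn (halfBox r) ω 0} ≤ Real.exp (3 / 2) * ρ ^ n * q := by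
    intro n hn
    have hMn : M ≤ n := by
      have := (Finset.mem_Ico.1 hn).1
      omega
    exact real_clusterCapIn_ge_le_exp_mul_root p hMn
  have hgeom : ∑ n ∈ Finset.Ico (T + 1) ((halfBox r).card + 1), ρ ^ n ≤ ρ ^ T * (1 + 2 * M) :=
    geom_sum_Ico_succ_le_pow_mul hρ0 hρ1 (one_div_one_sub_exp_le hM0) T _
  calc ∑ n ∈ Finset.Ico (T + 1) ((halfBox r).card + 1), μ.real {ω | n ≤ clusterCapIn (halfBox r) ω 0}
      ≤ ∑ n ∈ Finset.Ico (T + 1) ((halfBox r).card + 1), Real.exp (3 / 2) * ρ ^ n * q :=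
        Finset.sum_le_sum hterm
    _ = Real.exp (3 / 2) * (∑ n ∈ Finset.Ico (T + 1) ((halfBox r).card + 1), ρ ^ n) * q := by
        rw [Finset.mul_sum, Finset.sum_mul]
    _ ≤ Real.exp (3 / 2) * (ρ ^ T * (1 + 2 * M)) * q :=
        mul_le_mul_of_nonneg_right (mul_le_mul_of_nonneg_left hgeom (Real.exp_pos _).le) hq0
    _ = Real.exp (3 / 2) * ρ ^ T * (1 + 2 * M) * q := by ring

/-! ## §2 ARROW 1 with the logarithm of the ratio `q/π` -/

/-- **ARROW 1 at every `p`, ratio form**: `M_p(r) ≤ (2 + 3e^{3/2}) · M · π_p(r) · (1 + log⁺(q/π_p(r)))` with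
`M = typicalMax P^ℍ_p Λ_r`, `q = P^ℍ_p(|K_0 ∩ Λ_r| ≥ M)` (threshold `T = M + ⌈2M log⁺(q/π)⌉`; for `q ≤ π` there is
no logarithm at all). [folklore] -/
theorem mass_le_typicalMax_mul_log_ratio :
    ∀ (p : unitInterval) (r : ℕ), mass p r ≤ (2 + 3 * Real.exp (3 / 2)) * (typicalMax
      (floorDilutedPercolation 3 p 1) (halfBox r) : ℝ) * armProb p r * (1 + max 0 (Real.log
      ((floorDilutedPercolation 3 p 1).real {ω | typicalMax (floorDilutedPercolation 3 p 1) (halfBox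
      r) ≤ clusterCapIn (halfBox r) ω 0} / armProb p r))) := by
  intro p r
  have hmass : mass p r = ∑ x ∈ box 3 r, (floorDilutedPercolation 3 p 1).real (conn x ∩ arm r) := by
    unfold mass
    exact Finset.sum_congr rfl fun x _ => real_conn_inter_arm_eq_floorDiluted p x r
  rw [hmass, armProb_eq_floorDiluted p r]
  set μ := floorDilutedPercolation 3 p 1 with hμ
  set M := typicalMax μ (halfBox r) with hMdef
  set π := μ.real (arm r) with hπdef
  set q := μ.real {ω | M ≤ clusterCapIn (halfBox r) ω 0} with hqdef
  set E := Real.exp (3 / 2) with hE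
  have hE0 : 0 < E := Real.exp_pos _
  have hM2 : 2 ≤ M := two_le_typicalMax μ (halfBox_nonempty r)
  have hMR : (2 : ℝ) ≤ M := by exact_mod_cast hM2
  have hM0 : (0 : ℝ) < M := by linarith
  have hπ0 : 0 ≤ π := measureReal_nonneg
  have hq0 : 0 ≤ q := measureReal_nonneg
  rcases hπ0.eq_or_lt with hπz | hπpos
  · -- `π = 0`: both sides vanish
    have hle : ∑ x ∈ box 3 r, μ.real (conn x ∩ arm r) ≤ 0 := by
      calc ∑ x ∈ box 3 r, μ.real (conn x ∩ arm r) ≤ ∑ _x ∈ box 3 r, π :=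
            Finset.sum_le_sum fun x _ => measureReal_mono Set.inter_subset_right (measure_ne_top _ _)
        _ = 0 := by rw [← hπz, Finset.sum_const_zero]
    have hrhs : (2 + 3 * E) * (M : ℝ) * π * (1 + max 0 (Real.log (q / π))) = 0 := by
      rw [← hπz]; ring
    linarith
  · -- `π > 0`
    set L := max 0 (Real.log (q / π)) with hL
    have hL0 : 0 ≤ L := le_max_left _ _
    set T := M + ⌈2 * (M : ℝ) * L⌉₊ with hT
    have hTM : M ≤ T := Nat.le_add_right _ _
    have hTle : (T : ℝ) ≤ M + 2 * M * L + 1 := by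
      have := Nat.ceil_lt_add_one (show 0 ≤ 2 * (M : ℝ) * L by positivity)
      rw [hT]; push_cast; linarith
    have hTge : 2 * (M : ℝ) * L ≤ T := by
      have := Nat.le_ceil (2 * (M : ℝ) * L)
      rw [hT]; push_cast; linarith
    -- the geometric factor is at most `exp (-L)`
    have hρT : Real.exp (-1 / (2 * (M : ℝ))) ^ T ≤ Real.exp (-L) := by
      rw [← Real.exp_nat_mul]
      refine Real.exp_le_exp.2 ?_
      have : (T : ℝ) * (-1 / (2 * M)) = -(T / (2 * M)) := by ring
      rw [this, neg_le_neg_iff, le_div_iff₀ (by positivity)]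
      linarith
    -- and `q · exp(-L) ≤ π`
    have hqL : q * Real.exp (-L) ≤ π := by
      rcases le_or_gt q π with hqπ | hqπ
      · calc q * Real.exp (-L) ≤ q * 1 := by
              refine mul_le_mul_of_nonneg_left ?_ hq0
              rw [Real.exp_le_one_iff]
              linarith
          _ ≤ π := by rw [mul_one]; exact hqπ
      · have hqpos : 0 < q := hπpos.trans hqπ
        have hqne : q ≠ 0 := hqpos.ne'
        have hle1 : 1 ≤ q / π := by
          rw [le_div_iff₀ hπpos, one_mul]
          exact hqπ.le
        have hLeq : L = Real.log (q / π) := max_eq_right (Real.log_nonneg hle1)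
        rw [hLeq, Real.exp_neg, Real.exp_log (div_pos hqpos hπpos), inv_div, mul_div_assoc',
          mul_div_cancel_left₀ _ hqne]
    have step1 := sum_real_conn_inter_arm_le p r T
    have step2 := sum_Ico_real_clusterCapIn_ge_le_mul_root p r hTM
    have htail : ∑ n ∈ Finset.Ico (T + 1) ((halfBox r).card + 1),
        μ.real {ω | n ≤ clusterCapIn (halfBox r) ω 0} ≤ E * π * (1 + 2 * M) := by
      refine step2.trans ?_
      have h1 : 0 ≤ E * (1 + 2 * (M : ℝ)) := by positivity
      calc E * Real.exp (-1 / (2 * (M : ℝ))) ^ T * (1 + 2 * M) * q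
          = E * (1 + 2 * M) * (Real.exp (-1 / (2 * (M : ℝ))) ^ T * q) := by ring
        _ ≤ E * (1 + 2 * M) * (Real.exp (-L) * q) :=
            mul_le_mul_of_nonneg_left (mul_le_mul_of_nonneg_right hρT hq0) h1
        _ ≤ E * (1 + 2 * M) * π := by
            rw [mul_comm (Real.exp (-L)) q]
            exact mul_le_mul_of_nonneg_left hqL h1
        _ = E * π * (1 + 2 * M) := by ring
    have hmain : ∑ x ∈ box 3 r, μ.real (conn x ∩ arm r) ≤
        (M + 2 * M * L + 1) * π + E * π * (1 + 2 * M) := by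
      refine step1.trans (add_le_add ?_ htail)
      exact mul_le_mul_of_nonneg_right hTle hπ0
    have key : (2 + 3 * E) * (M : ℝ) * π * (1 + L) - ((M + 2 * M * L + 1) * π + E * π * (1 + 2 * M)) =
        π * ((M - 1) * (1 + E) + 3 * E * M * L) := by ring
    have hnonneg : 0 ≤ π * (((M : ℝ) - 1) * (1 + E) + 3 * E * M * L) := by
      have h1 : (0 : ℝ) ≤ (M - 1) * (1 + E) := mul_nonneg (by linarith) (by linarith)
      have h2 : (0 : ℝ) ≤ 3 * E * M * L := by positivity
      exact mul_nonneg hπ0 (add_nonneg h1 h2)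
    linarith

/-! ## §3 The ratio against the truncated half-space susceptibility: `q ≤ χ_ℍ^{(r)}(p) / M` -/

/-- **Markov plus the bridge**: `P^ℍ_p(|K_0 ∩ Λ_r| ≥ M) ≤ χ_ℍ^{(r)}(p) / M`, `M = typicalMax P^ℍ_p Λ_r`
(`M · q ≤ E^ℍ|K_0 ∩ Λ_r| = Σ_{y ∈ Λ_r} P^ℍ_p(0 ↔ y) ≤ Σ_{y ∈ Λ_r} P_p(0 ↔_ℍ y) ≤ Σ_{y ∈ B_r} P_p(0 ↔_ℍ y)`). [folklore] -/
theorem real_typicalMax_le_clusterCapIn_le_chiH_div (p : unitInterval) (r : ℕ) :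
    (floorDilutedPercolation 3 p 1).real
        {ω | typicalMax (floorDilutedPercolation 3 p 1) (halfBox r) ≤ clusterCapIn (halfBox r) ω 0} ≤
      chiH p r / typicalMax (floorDilutedPercolation 3 p 1) (halfBox r) := by
  set μ := floorDilutedPercolation 3 p 1 with hμ
  set M := typicalMax μ (halfBox r) with hMdef
  have hM2 : 2 ≤ M := two_le_typicalMax μ (halfBox_nonempty r)
  have hMR : (2 : ℝ) ≤ M := by exact_mod_cast hM2
  have hM0 : (0 : ℝ) < M := by linarith
  rw [le_div_iff₀ hM0, mul_comm]
  have hmarkov := mul_meas_ge_le_integral_of_nonneg (μ := μ)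
    (f := fun ω => (clusterCapIn (halfBox r) ω 0 : ℝ)) (ae_of_all _ fun ω => Nat.cast_nonneg _)
    (integrable_clusterCapIn μ (halfBox r) 0) (M : ℝ)
  have hset : {ω : BondConfig V3 | (M : ℝ) ≤ (clusterCapIn (halfBox r) ω 0 : ℝ)} =
      {ω | M ≤ clusterCapIn (halfBox r) ω 0} := by
    ext ω
    simp only [Set.mem_setOf_eq, Nat.cast_le]
  rw [hset] at hmarkov
  refine hmarkov.trans ?_
  rw [integral_clusterCapIn_eq_sum μ (halfBox r) 0, chiH]
  calc ∑ y ∈ halfBox r, μ.real (openConn 0 y) ≤ ∑ y ∈ halfBox r, (Pp p).real (conn y) :=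
        Finset.sum_le_sum fun y _ => real_openConn_floorDiluted_le_real_openConnIn p zero_mem_Hs y
    _ ≤ ∑ y ∈ box 3 r, (Pp p).real (conn y) :=
        Finset.sum_le_sum_of_subset_of_nonneg (halfBox_subset_box r) fun _ _ _ => measureReal_nonneg

/-- `χ_ℍ^{(r)}(p) ≥ 0`. [folklore] -/
theorem chiH_nonneg (p : unitInterval) (r : ℕ) : 0 ≤ chiH p r :=
  Finset.sum_nonneg fun _ _ => measureReal_nonneg

/-- **ARROW 1 at every `p`, susceptibility-ratio form**:
`M_p(r) ≤ (2 + 3e^{3/2}) · M · π_p(r) · (1 + log⁺(χ_ℍ^{(r)}(p) / (M π_p(r))))`, `M = typicalMax P^ℍ_p Λ_r` — the logarithm of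
ARROW 1 is `log⁺` of the first-moment ratio `W(r) = χ_ℍ^{(r)}/(M π)`. [folklore] -/
theorem mass_le_typicalMax_mul_log_chiRatio :
    ∀ (p : unitInterval) (r : ℕ), mass p r ≤ (2 + 3 * Real.exp (3 / 2)) * (typicalMax
      (floorDilutedPercolation 3 p 1) (halfBox r) : ℝ) * armProb p r * (1 + max 0 (Real.log (chiH p
      r / ((typicalMax (floorDilutedPercolation 3 p 1) (halfBox r) : ℝ) * armProb p r)))) := by
  intro p r
  refine (mass_le_typicalMax_mul_log_ratio p r).trans ?_
  set μ := floorDilutedPercolation 3 p 1 with hμ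
  set M := typicalMax μ (halfBox r) with hMdef
  set π := armProb p r with hπdef
  set q := μ.real {ω | M ≤ clusterCapIn (halfBox r) ω 0} with hqdef
  have hπ0 : 0 ≤ π := armProb_nonneg p r
  have hq0 : 0 ≤ q := measureReal_nonneg
  have hratio : q / π ≤ chiH p r / (M * π) := by
    rcases hπ0.eq_or_lt with hπz | hπpos
    · rw [← hπz, mul_zero, div_zero, div_zero]
    · rw [← div_div]
      exact div_le_div_of_nonneg_right (real_typicalMax_le_clusterCapIn_le_chiH_div p r) hπpos.le
  have hlog : max 0 (Real.log (q / π)) ≤ max 0 (Real.log (chiH p r / (M * π))) :=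
    Real.posLog_le_posLog (div_nonneg hq0 hπ0) hratio
  have hK : 0 ≤ (2 + 3 * Real.exp (3 / 2)) * (M : ℝ) * π := by positivity
  have h1 : 1 + max 0 (Real.log (q / π)) ≤ 1 + max 0 (Real.log (chiH p r / (M * π))) := by linarith
  exact mul_le_mul_of_nonneg_left h1 hK

/-! ## §4 At `p_c`: a bounded ratio `W` removes the logarithm -/

/-- **No-loss arithmetic**: `typicalMax P^ℍ_{p_c} Λ_r ≤ C r^s` and `χ_ℍ^{(r)}(p_c) ≤ K · typicalMax · π_{p_c}(r)` (all `r ≥ 1`)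
give `MassBoundAt p_c s` — with the SAME exponent `s` (constant `(2 + 3e^{3/2})(1 + log⁺ K) max(C,0)`). [folklore] -/
theorem massBoundAt_of_typicalMax_le_of_chiRatio :
    ∀ (s C K : ℝ), (∀ r : ℕ, 1 ≤ r → (typicalMax (floorDilutedPercolation 3 (criticalProbI 3) 1)
      (halfBox r) : ℝ) ≤ C * (r : ℝ) ^ s) → (∀ r : ℕ, 1 ≤ r → chiH (criticalProbI 3) r ≤ K *
      (typicalMax (floorDilutedPercolation 3 (criticalProbI 3) 1) (halfBox r) : ℝ) * armProb
      (criticalProbI 3) r) → MassBoundAt (criticalProbI 3) s := by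
  intro s C K hM hW
  refine ⟨(2 + 3 * Real.exp (3 / 2)) * (1 + max 0 (Real.log K)) * max C 0, fun r hr => ?_⟩
  set M := (typicalMax (floorDilutedPercolation 3 (criticalProbI 3) 1) (halfBox r) : ℝ) with hMdef
  set π := armProb (criticalProbI 3) r with hπdef
  have hπ : 0 < π := armProb_criticalProbI_pos r
  have hM2 : (2 : ℝ) ≤ M := by
    rw [hMdef]
    exact_mod_cast two_le_typicalMax _ (halfBox_nonempty r)
  have hM0 : 0 < M := by linarith
  have hratio : chiH (criticalProbI 3) r / (M * π) ≤ K := by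
    rw [div_le_iff₀ (mul_pos hM0 hπ)]
    calc chiH (criticalProbI 3) r ≤ K * M * π := hW r hr
      _ = K * (M * π) := by ring
  have hchi0 : 0 ≤ chiH (criticalProbI 3) r / (M * π) := div_nonneg (chiH_nonneg _ _) (by positivity)
  have hlog : max 0 (Real.log (chiH (criticalProbI 3) r / (M * π))) ≤ max 0 (Real.log K) :=
    Real.posLog_le_posLog hchi0 hratio
  have hL0 : 0 ≤ max 0 (Real.log K) := le_max_left _ _
  have hr0 : (0 : ℝ) < r := by exact_mod_cast hr
  have hrs : 0 ≤ (r : ℝ) ^ s := Real.rpow_nonneg hr0.le s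
  have hMC : M ≤ max C 0 * (r : ℝ) ^ s := (hM r hr).trans (mul_le_mul_of_nonneg_right (le_max_left _ _) hrs)
  calc mass (criticalProbI 3) r
      ≤ (2 + 3 * Real.exp (3 / 2)) * M * π * (1 + max 0 (Real.log (chiH (criticalProbI 3) r / (M * π)))) :=
        mass_le_typicalMax_mul_log_chiRatio (criticalProbI 3) r
    _ ≤ (2 + 3 * Real.exp (3 / 2)) * M * π * (1 + max 0 (Real.log K)) := by gcongr
    _ = (2 + 3 * Real.exp (3 / 2)) * (1 + max 0 (Real.log K)) * M * π := by ring
    _ ≤ (2 + 3 * Real.exp (3 / 2)) * (1 + max 0 (Real.log K)) * (max C 0 * (r : ℝ) ^ s) * π := by gcongr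
    _ = (2 + 3 * Real.exp (3 / 2)) * (1 + max 0 (Real.log K)) * max C 0 * (r : ℝ) ^ s * π := by ring

/-- **B ⟸ `SquareSubharmonic` (stmt-CriticalPhenomena-11506, verbatim) ∧ a bounded first-moment ratio
`χ_ℍ^{(r)}(p_c) ≤ K · typicalMax P^ℍ_{p_c} Λ_r · π_{p_c}(r)`**: `SquareSubharmonic` gives `typicalMax ≤ C' r^{11/4}` exactly
(`tau_criticalProbI_le_of_subharmonicPower` at `s = 2`, ball sums at rate `a = 1/2`, ENGINE 4), and the bounded ratio
removes the logarithm of ARROW 1 (`massBoundAt_of_typicalMax_le_of_chiRatio`). [folklore] -/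
theorem tallClusterMassBound_of_squareSubharmonic_of_chiRatio :
    Summit.CriticalPhenomena.PercolationContinuityZ3.Theses.PercSubharmonicSquare.SquareSubharmonic
      → (∃ K : ℝ, ∀ r : ℕ, 1 ≤ r → chiH (criticalProbI 3) r ≤ K * (typicalMax
      (floorDilutedPercolation 3 (criticalProbI 3) 1) (halfBox r) : ℝ) * armProb (criticalProbI 3)
      r) →
      Summit.CriticalPhenomena.PercolationContinuityZ3.Theses.PercLowPointHalfSpace.TallClusterMassBound := by
  intro h hW
  obtain ⟨K, hK⟩ := hW
  obtain ⟨R, hR⟩ := h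
  -- `SquareSubharmonic` is sub-mean-value of `τ_p^s` with the real exponent `s = 2`
  have hsub : ∀ p : unitInterval, (p : ℝ) < criticalProb (zdGraph 3) (0 : Site 3) →
      ∀ x : Site 3, (R : ℝ) < ‖x‖ →
        tau 3 p 0 x ^ (2 : ℝ) ≤
          (1 / 6 : ℝ) * ∑ i : Fin 3, (tau 3 p 0 (x + Pi.single i 1) ^ (2 : ℝ) + tau 3 p 0 (x - Pi.single i 1) ^ (2 : ℝ)) := by
    intro p hp x hx
    simpa only [Real.rpow_two] using hR p hp x hx
  obtain ⟨C, hC0, hC⟩ := tau_criticalProbI_le_of_subharmonicPower (s := 2) (by norm_num) hsub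
  have hpt : ∀ x : Site 3, x ≠ 0 → tau 3 (criticalProbI 3) 0 x ≤ C * ‖x‖ ^ (-((1 : ℝ) / 2)) := by
    intro x hx
    simpa using hC x hx
  have hball := ballSum_le_of_pointwise (a := 1 / 2) (by norm_num) hC0.le hpt
  obtain ⟨C', hC'⟩ := typicalMax_le_of_ballTwoPointDecay (a := 1 / 2) (by norm_num) hball
  refine tallClusterMassBound_iff.2 (massBoundAt_of_typicalMax_le_of_chiRatio ((11 : ℝ) / 4) C' K ?_ hK)
  intro r hr
  have e : ((6 : ℝ) - 1 / 2) / 2 = (11 : ℝ) / 4 := by norm_num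
  rw [← e]
  exact hC' r hr

end Summit.CriticalPhenomena.PercolationContinuityZ3.Theorems.TallClusterMassBound.TightnessLine

end
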